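import Summits.NavierStokesRegularity.NavierStokesRegularity.Theses.RellichScar
import Summits.NavierStokesRegularity.NavierStokesRegularity.Theorems.ScarRigidity.Negative.LogicAndLoadBearing
import Literature.Analysis.FluidPDE.TypeIAncientMild
import Literature.Analysis.FluidPDE.ParasiticSlabFlow
import Literature.Analysis.FluidPDE.NewtonPotential
import Literature.Analysis.FluidPDE.RieszKernelBounds
import Summits.NavierStokesRegularity.NavierStokesRegularity.Theorems.RellichScarScarRigidityLogConvexityL2Energy
import HarnessLib

/-!
# `ScarRigidity` — line `finite-energy-log-convexity`, stub `stub_coulombEnergyPackage`: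
# kernel bounds and elementary weights for the Newtonian potential of an apex density

Helper file 2 of S4-E (`stub_coulombEnergyPackage`, crux stmt-NavierStokesRegularity-11717). The
Coulomb energy of the difference `w = V₁ - V₂` of two apex profiles is realised through the
Newtonian potential `Γ ⋆ w`, `Γ = -1/(4π|z|)` (`newtonKernel`), split at the fixed radii `(1, 2)`
into the tree's near kernel `Γ₀ = newtonNear 1 2` (compactly supported, `L¹`) and far kernel
`Γ∞ = newtonFar 1 2` (smooth). Quantitative inputs shared by the files of the package:
`|Γ∞| ≲ (1+|z|)⁻¹`, `‖DΓ∞‖ ≲ (1+|z|)⁻²`, `‖D∂ₐΓ∞‖ ≲ ‖a‖(1+|z|)⁻³`; the apex weight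
`ρ⁻³ = (‖y‖ + a)⁻³` against the translated weights `(1+‖x-y‖)⁻ᵏ` is in `L¹(dy)` with bounds
uniform in `x` (products into sums of integrable pure weights); `ρ⁻³ ≤ a^{θ-3}‖y‖^{-θ}`,
`(1+‖z‖)⁻ᵏ ≤ ‖z‖^{-β}`; the tree's Riesz composition bound
(`RieszKernel.exists_lintegral_powKer_mul_powKer_le`, Stein V §1) in Bochner form,
`∫ ‖x-y‖^{-β}‖y‖^{-α} dy ≤ K‖x‖^{3-α-β}`; and `ρ⁻³ ‖x‖^{-s} ∈ L¹(ℝ³)` for `0 < s < 3`.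
-/

noncomputable section

open Set Filter Function MeasureTheory Metric TopologicalSpace
open scoped Topology ENNReal NNReal InnerProductSpace RealInnerProductSpace
open Literature.Analysis.FluidPDE
open Summit.NavierStokesRegularity.NavierStokesRegularity.Theses.RellichScar
open Summit.NavierStokesRegularity.NavierStokesRegularity.Theorems.ScarRigidity.Negative

set_option linter.dupNamespace false

namespace Summit.NavierStokesRegularity.NavierStokesRegularity.Theorems.RellichScarScarRigidity

open Real RieszKernel

/-! ## Decay of the far kernel and of its first two derivatives -/

/-- **`|Γ∞(z)| ≤ K₀ (1 + ‖z‖)⁻¹`** for the far kernel at radii `(1, 2)` (bounded on the ball of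
radius `2`, equal to `Γ = -1/(4π|z|)` outside). [folklore] -/
theorem exists_abs_newtonFar_le :
    ∃ K₀ : ℝ, 0 ≤ K₀ ∧ ∀ z : (EuclideanSpace ℝ (Fin 3)), |newtonFar 1 2 z| ≤ K₀ * (1 + ‖z‖)⁻¹ := by
  obtain ⟨⟨M₀, hM₀⟩, -, -, -, -⟩ := exists_bound_newtonFar_derivs (r₀ := (1 : ℝ)) (r₁ := 2)
    one_pos one_lt_two
  have hM₀0 : 0 ≤ M₀ := (norm_nonneg _).trans (hM₀ 0)
  refine ⟨3 * M₀ + 1, by positivity, fun z => ?_⟩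
  have hz1 : 0 < 1 + ‖z‖ := by positivity
  by_cases hz : ‖z‖ ≤ 2
  · have h := hM₀ z
    rw [Real.norm_eq_abs] at h
    calc |newtonFar 1 2 z| ≤ M₀ := h
      _ ≤ (3 * M₀ + 1) * (1 + ‖z‖)⁻¹ := by
          rw [← div_eq_mul_inv, le_div_iff₀ hz1]; nlinarith
  · rw [not_le] at hz
    have hzpos : 0 < ‖z‖ := by linarith
    calc |newtonFar 1 2 z| ≤ (4 * π * ‖z‖)⁻¹ := abs_newtonFar_le 1 2 z
      _ ≤ (1 + ‖z‖)⁻¹ := by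
          apply inv_anti₀ hz1
          nlinarith [Real.pi_gt_three]
      _ ≤ (3 * M₀ + 1) * (1 + ‖z‖)⁻¹ := by
          apply le_mul_of_one_le_left (inv_nonneg.2 hz1.le); linarith

/-- **`‖DΓ∞(z)‖ ≤ K₁ (1 + ‖z‖)⁻²`** (bounded on the ball, `‖DΓ(z)‖ = (4π|z|²)⁻¹` outside). [folklore] -/
theorem exists_norm_fderiv_newtonFar_le :
    ∃ K₁ : ℝ, 0 ≤ K₁ ∧ ∀ z : (EuclideanSpace ℝ (Fin 3)), ‖fderiv ℝ (newtonFar 1 2) z‖ ≤ K₁ * ((1 + ‖z‖) ^ 2)⁻¹ := by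
  obtain ⟨-, ⟨M₁, hM₁⟩, -, -, -⟩ := exists_bound_newtonFar_derivs (r₀ := (1 : ℝ)) (r₁ := 2)
    one_pos one_lt_two
  have hM₁0 : 0 ≤ M₁ := (norm_nonneg _).trans (hM₁ 0)
  refine ⟨9 * M₁ + 1, by positivity, fun z => ?_⟩
  have hz1 : 0 < 1 + ‖z‖ := by positivity
  by_cases hz : ‖z‖ ≤ 2
  · have h9 : (1 + ‖z‖) ^ 2 ≤ 9 := by nlinarith [norm_nonneg z]
    calc ‖fderiv ℝ (newtonFar 1 2) z‖ ≤ M₁ := hM₁ z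
      _ ≤ (9 * M₁ + 1) * ((1 + ‖z‖) ^ 2)⁻¹ := by
          rw [← div_eq_mul_inv, le_div_iff₀ (by positivity)]
          nlinarith [mul_le_mul_of_nonneg_left h9 hM₁0]
  · rw [not_le] at hz
    have hz0 : z ≠ 0 := by rintro rfl; norm_num at hz
    rw [(newtonFar_fderiv_iterates_eq zero_le_one one_lt_two hz).2.1, norm_fderiv_newtonKernel hz0]
    calc (4 * π * ‖z‖ ^ 2)⁻¹ ≤ ((1 + ‖z‖) ^ 2)⁻¹ := by
          apply inv_anti₀ (by positivity)
          nlinarith [Real.pi_gt_three, norm_nonneg z]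
      _ ≤ (9 * M₁ + 1) * ((1 + ‖z‖) ^ 2)⁻¹ := by
          apply le_mul_of_one_le_left (by positivity); linarith

/-- **`‖D(∂ₐΓ∞)(z)‖ ≤ K₂ ‖a‖ (1 + ‖z‖)⁻³`** for the directional derivatives `∂ₐΓ∞ = DΓ∞(·) a`
(bounded second derivative on the ball, `|D²Γ(z)(a,b)| ≤ ‖a‖‖b‖/(π|z|³)` outside). [folklore] -/
theorem exists_norm_fderiv_fderiv_newtonFar_apply_le :
    ∃ K₂ : ℝ, 0 ≤ K₂ ∧ ∀ z a : (EuclideanSpace ℝ (Fin 3)),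
      ‖fderiv ℝ (fun y => fderiv ℝ (newtonFar 1 2) y a) z‖ ≤ K₂ * ‖a‖ * ((1 + ‖z‖) ^ 3)⁻¹ := by
  obtain ⟨-, -, ⟨M₂, hM₂⟩, -, -⟩ := exists_bound_newtonFar_derivs (r₀ := (1 : ℝ)) (r₁ := 2)
    one_pos one_lt_two
  have hM₂0 : 0 ≤ M₂ := (norm_nonneg (fderiv ℝ (fderiv ℝ (newtonFar 1 2)) 0)).trans (hM₂ 0)
  have hsm : ContDiff ℝ 2 (newtonFar (1 : ℝ) 2) := contDiff_newtonFar one_pos one_lt_two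
  have hdiff : ∀ z : (EuclideanSpace ℝ (Fin 3)), DifferentiableAt ℝ (fderiv ℝ (newtonFar (1 : ℝ) 2)) z := fun z =>
    ((hsm.fderiv_right (m := 1) le_rfl).differentiable one_ne_zero) z
  -- the directional second derivative is the flip of `D²Γ∞`
  have hflip : ∀ z a : (EuclideanSpace ℝ (Fin 3)), fderiv ℝ (fun y => fderiv ℝ (newtonFar 1 2) y a) z =
      (fderiv ℝ (fderiv ℝ (newtonFar 1 2)) z).flip a := fun z a => by
    rw [fderiv_clm_apply (hdiff z) (differentiableAt_const a)]
    simp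
  refine ⟨27 * M₂ + 3, by positivity, fun z a => ?_⟩
  have hz1 : 0 < 1 + ‖z‖ := by positivity
  by_cases hz : ‖z‖ ≤ 2
  · have h1 : ‖fderiv ℝ (fun y => fderiv ℝ (newtonFar 1 2) y a) z‖ ≤ M₂ * ‖a‖ := by
      rw [hflip]
      calc ‖(fderiv ℝ (fderiv ℝ (newtonFar 1 2)) z).flip a‖
          ≤ ‖(fderiv ℝ (fderiv ℝ (newtonFar 1 2)) z).flip‖ * ‖a‖ := ContinuousLinearMap.le_opNorm _ _
        _ ≤ M₂ * ‖a‖ := by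
            rw [ContinuousLinearMap.opNorm_flip]
            exact mul_le_mul_of_nonneg_right (hM₂ z) (norm_nonneg _)
    calc ‖fderiv ℝ (fun y => fderiv ℝ (newtonFar 1 2) y a) z‖ ≤ M₂ * ‖a‖ := h1
      _ ≤ (27 * M₂ + 3) * ‖a‖ * ((1 + ‖z‖) ^ 3)⁻¹ := by
          rw [← div_eq_mul_inv, le_div_iff₀ (by positivity)]
          have h27 : (1 + ‖z‖) ^ 3 ≤ 27 := by
            have h := pow_le_pow_left₀ hz1.le (by linarith : 1 + ‖z‖ ≤ 3) 3
            norm_num at h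
            exact h
          have ha := norm_nonneg a
          nlinarith [mul_nonneg hM₂0 ha, mul_nonneg ha (show (0:ℝ) ≤ 27 - (1 + ‖z‖) ^ 3 by linarith)]
  · rw [not_le] at hz
    have hz0 : z ≠ 0 := by rintro rfl; norm_num at hz
    -- near `z` the far kernel is the Newtonian kernel
    have hev : (fun y => fderiv ℝ (newtonFar 1 2) y a) =ᶠ[𝓝 z]
        fun y => fderiv ℝ newtonKernel y a := by
      have e1 := (newtonFar_eventuallyEq_newtonKernel zero_le_one one_lt_two hz).fderiv (𝕜 := ℝ)
      exact e1.mono fun y hy => by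
        show (fderiv ℝ (newtonFar 1 2) y) a = (fderiv ℝ newtonKernel y) a
        rw [hy]
    rw [hev.fderiv_eq]
    refine ContinuousLinearMap.opNorm_le_bound _ (by positivity) fun b => ?_
    rw [Real.norm_eq_abs]
    calc |fderiv ℝ (fun y => fderiv ℝ newtonKernel y a) z b| ≤ ‖a‖ * ‖b‖ / (π * ‖z‖ ^ 3) :=
          abs_fderiv_fderiv_newtonKernel_apply_le hz0 a b
      _ = ‖a‖ * (π * ‖z‖ ^ 3)⁻¹ * ‖b‖ := by ring
      _ ≤ (27 * M₂ + 3) * ‖a‖ * ((1 + ‖z‖) ^ 3)⁻¹ * ‖b‖ := by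
          apply mul_le_mul_of_nonneg_right _ (norm_nonneg b)
          rw [mul_comm ((27 : ℝ) * M₂ + 3) ‖a‖, mul_assoc]
          apply mul_le_mul_of_nonneg_left _ (norm_nonneg a)
          have hzpos : 0 < ‖z‖ := by linarith
          have h8 : (1 + ‖z‖) ^ 3 ≤ (2 * ‖z‖) ^ 3 :=
            pow_le_pow_left₀ hz1.le (by linarith) 3
          have hkey : (1 + ‖z‖) ^ 3 ≤ 3 * (π * ‖z‖ ^ 3) := by
            nlinarith [Real.pi_gt_three, pow_pos hzpos 3]
          calc (π * ‖z‖ ^ 3)⁻¹ ≤ 3 * ((1 + ‖z‖) ^ 3)⁻¹ := by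
                rw [← div_eq_mul_inv, le_div_iff₀ (by positivity), inv_mul_le_iff₀ (by positivity)]
                linarith
            _ ≤ (27 * M₂ + 3) * ((1 + ‖z‖) ^ 3)⁻¹ :=
                mul_le_mul_of_nonneg_right (by linarith) (by positivity)

/-! ## Elementary integrable weights on `(EuclideanSpace ℝ (Fin 3))` -/

/-- `y ↦ (1 + ‖x - y‖)^{-r}` is integrable on `(EuclideanSpace ℝ (Fin 3))` for a natural number `r > 3` (translation of
Mathlib's `integrable_one_add_norm`). [folklore] -/
theorem integrable_inv_one_add_norm_sub_pow (x : (EuclideanSpace ℝ (Fin 3))) {r : ℕ} (hr : 3 < r) :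
    Integrable (fun y : (EuclideanSpace ℝ (Fin 3)) => ((1 + ‖x - y‖) ^ r)⁻¹) volume := by
  have hr' : (Module.finrank ℝ (EuclideanSpace ℝ (Fin 3)) : ℝ) < (r : ℝ) := by
    rw [finrank_euclideanSpace, Fintype.card_fin]; exact_mod_cast hr
  have h0 : Integrable (fun y : (EuclideanSpace ℝ (Fin 3)) => ((1 + ‖y‖) ^ r)⁻¹) volume := by
    refine (integrable_one_add_norm hr').congr (Eventually.of_forall fun y => ?_)
    show (1 + ‖y‖) ^ (-(r : ℝ)) = ((1 + ‖y‖) ^ r)⁻¹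
    rw [Real.rpow_neg (by positivity), Real.rpow_natCast]
  exact h0.comp_sub_left x

/-- Translation invariance: `∫ (1 + ‖x - y‖)^{-r} dy = ∫ (1 + ‖y‖)^{-r} dy`. [folklore] -/
theorem integral_inv_one_add_norm_sub_pow (x : (EuclideanSpace ℝ (Fin 3))) (r : ℕ) :
    ∫ y : (EuclideanSpace ℝ (Fin 3)), ((1 + ‖x - y‖) ^ r)⁻¹ = ∫ y : (EuclideanSpace ℝ (Fin 3)), ((1 + ‖y‖) ^ r)⁻¹ :=
  integral_sub_left_eq_self (fun y : (EuclideanSpace ℝ (Fin 3)) => ((1 + ‖y‖) ^ r)⁻¹) volume x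

/-- Products into sums: `(1+‖x-y‖)⁻ᵏ ρ⁻³ ≤ ((1+‖x-y‖)⁻²ᵏ + ρ⁻⁶)/2`. [folklore] -/
theorem inv_pow_mul_inv_cube_le (x y : (EuclideanSpace ℝ (Fin 3))) (a : ℝ) (k : ℕ) :
    ((1 + ‖x - y‖) ^ k)⁻¹ * ((‖y‖ + a) ^ 3)⁻¹ ≤
      (((1 + ‖x - y‖) ^ (2 * k))⁻¹ + ((‖y‖ + a) ^ 6)⁻¹) / 2 := by
  have e1 : ((1 + ‖x - y‖) ^ (2 * k))⁻¹ = (((1 + ‖x - y‖) ^ k)⁻¹) ^ 2 := by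
    rw [← inv_pow, ← inv_pow, ← pow_mul, mul_comm]
  have e2 : ((‖y‖ + a) ^ 6)⁻¹ = (((‖y‖ + a) ^ 3)⁻¹) ^ 2 := by
    rw [← inv_pow, ← inv_pow, ← pow_mul]
  rw [e1, e2]
  nlinarith [sq_nonneg (((1 + ‖x - y‖) ^ k)⁻¹ - ((‖y‖ + a) ^ 3)⁻¹)]

/-- Products into sums, `k = 1`: `(1+‖x-y‖)⁻¹ ρ⁻³ ≤ (1+‖x-y‖)⁻⁴/4 + (3/4) ρ⁻⁴` (Young with the
exponents `4, 4/3`, via two squares). [folklore] -/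
theorem inv_mul_inv_cube_le (x y : (EuclideanSpace ℝ (Fin 3))) {a : ℝ} (ha : 0 < a) :
    (1 + ‖x - y‖)⁻¹ * ((‖y‖ + a) ^ 3)⁻¹ ≤
      ((1 + ‖x - y‖) ^ 4)⁻¹ / 4 + 3 / 4 * ((‖y‖ + a) ^ 4)⁻¹ := by
  have key : ∀ p s : ℝ, 0 ≤ p → 0 ≤ s → p * s ^ 3 ≤ p ^ 4 / 4 + 3 / 4 * s ^ 4 := by
    intro p s hp hs
    nlinarith [sq_nonneg (p * s - s ^ 2), sq_nonneg (p ^ 2 - s ^ 2), mul_nonneg hp hs,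
      pow_nonneg hs 2, pow_nonneg hp 2]
  have h := key (1 + ‖x - y‖)⁻¹ (‖y‖ + a)⁻¹ (inv_nonneg.2 (by positivity))
    (inv_nonneg.2 (by positivity))
  simpa only [inv_pow] using h

/-- Continuity of the translated kernel weight `y ↦ ((1 + ‖x - y‖)^k)⁻¹`. [folklore] -/
theorem continuous_inv_one_add_norm_sub_pow (x : (EuclideanSpace ℝ (Fin 3))) (k : ℕ) :
    Continuous fun y : (EuclideanSpace ℝ (Fin 3)) => ((1 + ‖x - y‖) ^ k)⁻¹ :=
  ((continuous_const.add (continuous_const.sub continuous_id).norm).pow k).inv₀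
    fun y => (pow_pos (add_pos_of_pos_of_nonneg one_pos (norm_nonneg (x - y))) k).ne'

/-- Continuity of the apex weight `y ↦ ((‖y‖ + a)^p)⁻¹` for `a > 0`. [folklore] -/
theorem continuous_inv_norm_add_pow {a : ℝ} (ha : 0 < a) (p : ℕ) :
    Continuous fun y : (EuclideanSpace ℝ (Fin 3)) => ((‖y‖ + a) ^ p)⁻¹ :=
  ((continuous_norm.add continuous_const).pow p).inv₀
    fun _ => (pow_pos (add_pos_of_nonneg_of_pos (norm_nonneg _) ha) p).ne'

/-- **`(1+‖x-y‖)⁻ᵏ ρ(y)⁻³ ∈ L¹(dy)` for `k ≥ 2`, with `∫ ≤ (∫(1+‖y‖)⁻²ᵏ + ∫ρ⁻⁶)/2` uniformly in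
`x`.** [folklore] -/
theorem integrable_inv_pow_mul_inv_cube (x : (EuclideanSpace ℝ (Fin 3))) {a : ℝ} (ha : 0 < a) {k : ℕ} (hk : 2 ≤ k) :
    Integrable (fun y : (EuclideanSpace ℝ (Fin 3)) => ((1 + ‖x - y‖) ^ k)⁻¹ * ((‖y‖ + a) ^ 3)⁻¹) volume ∧
      ∫ y : (EuclideanSpace ℝ (Fin 3)), ((1 + ‖x - y‖) ^ k)⁻¹ * ((‖y‖ + a) ^ 3)⁻¹ ≤
        ((∫ y : (EuclideanSpace ℝ (Fin 3)), ((1 + ‖y‖) ^ (2 * k))⁻¹) + ∫ y : (EuclideanSpace ℝ (Fin 3)), ((‖y‖ + a) ^ 6)⁻¹) / 2 := by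
  have h2k : 3 < 2 * k := by omega
  have hmaj : Integrable (fun y : (EuclideanSpace ℝ (Fin 3)) => (((1 + ‖x - y‖) ^ (2 * k))⁻¹ + ((‖y‖ + a) ^ 6)⁻¹) / 2)
      volume :=
    ((integrable_inv_one_add_norm_sub_pow x h2k).add
      (integrable_inv_norm_add_pow ha (by norm_num))).div_const 2
  have hnn : ∀ y : (EuclideanSpace ℝ (Fin 3)), 0 ≤ ((1 + ‖x - y‖) ^ k)⁻¹ * ((‖y‖ + a) ^ 3)⁻¹ := fun y => by positivity
  have hint : Integrable (fun y : (EuclideanSpace ℝ (Fin 3)) => ((1 + ‖x - y‖) ^ k)⁻¹ * ((‖y‖ + a) ^ 3)⁻¹) volume :=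
    hmaj.mono' ((continuous_inv_one_add_norm_sub_pow x k).mul
      (continuous_inv_norm_add_pow ha 3)).aestronglyMeasurable
      (Eventually.of_forall fun y => by
        rw [Real.norm_of_nonneg (hnn y)]; exact inv_pow_mul_inv_cube_le x y a k)
  refine ⟨hint, ?_⟩
  calc ∫ y : (EuclideanSpace ℝ (Fin 3)), ((1 + ‖x - y‖) ^ k)⁻¹ * ((‖y‖ + a) ^ 3)⁻¹
      ≤ ∫ y : (EuclideanSpace ℝ (Fin 3)), (((1 + ‖x - y‖) ^ (2 * k))⁻¹ + ((‖y‖ + a) ^ 6)⁻¹) / 2 :=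
        integral_mono hint hmaj fun y => inv_pow_mul_inv_cube_le x y a k
    _ = ((∫ y : (EuclideanSpace ℝ (Fin 3)), ((1 + ‖y‖) ^ (2 * k))⁻¹) + ∫ y : (EuclideanSpace ℝ (Fin 3)), ((‖y‖ + a) ^ 6)⁻¹) / 2 := by
        rw [integral_div, integral_add (integrable_inv_one_add_norm_sub_pow x h2k)
          (integrable_inv_norm_add_pow ha (by norm_num)), integral_inv_one_add_norm_sub_pow]

/-- **`(1+‖x-y‖)⁻¹ ρ(y)⁻³ ∈ L¹(dy)` with `∫ ≤ ∫(1+‖y‖)⁻⁴/4 + (3/4)∫ρ⁻⁴`, uniformly in `x`.** [folklore] -/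
theorem integrable_inv_mul_inv_cube (x : (EuclideanSpace ℝ (Fin 3))) {a : ℝ} (ha : 0 < a) :
    Integrable (fun y : (EuclideanSpace ℝ (Fin 3)) => (1 + ‖x - y‖)⁻¹ * ((‖y‖ + a) ^ 3)⁻¹) volume ∧
      ∫ y : (EuclideanSpace ℝ (Fin 3)), (1 + ‖x - y‖)⁻¹ * ((‖y‖ + a) ^ 3)⁻¹ ≤
        (∫ y : (EuclideanSpace ℝ (Fin 3)), ((1 + ‖y‖) ^ 4)⁻¹) / 4 + 3 / 4 * ∫ y : (EuclideanSpace ℝ (Fin 3)), ((‖y‖ + a) ^ 4)⁻¹ := by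
  have hmaj : Integrable (fun y : (EuclideanSpace ℝ (Fin 3)) => ((1 + ‖x - y‖) ^ 4)⁻¹ / 4 + 3 / 4 * ((‖y‖ + a) ^ 4)⁻¹)
      volume :=
    ((integrable_inv_one_add_norm_sub_pow x (by norm_num)).div_const 4).add
      ((integrable_inv_norm_add_pow ha (by norm_num)).const_mul _)
  have hnn : ∀ y : (EuclideanSpace ℝ (Fin 3)), 0 ≤ (1 + ‖x - y‖)⁻¹ * ((‖y‖ + a) ^ 3)⁻¹ := fun y => by positivity
  have hc1 : Continuous fun y : (EuclideanSpace ℝ (Fin 3)) => (1 + ‖x - y‖)⁻¹ := by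
    simpa using continuous_inv_one_add_norm_sub_pow x 1
  have hint : Integrable (fun y : (EuclideanSpace ℝ (Fin 3)) => (1 + ‖x - y‖)⁻¹ * ((‖y‖ + a) ^ 3)⁻¹) volume :=
    hmaj.mono' (hc1.mul (continuous_inv_norm_add_pow ha 3)).aestronglyMeasurable
      (Eventually.of_forall fun y => by
        rw [Real.norm_of_nonneg (hnn y)]; exact inv_mul_inv_cube_le x y ha)
  refine ⟨hint, ?_⟩
  calc ∫ y : (EuclideanSpace ℝ (Fin 3)), (1 + ‖x - y‖)⁻¹ * ((‖y‖ + a) ^ 3)⁻¹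
      ≤ ∫ y : (EuclideanSpace ℝ (Fin 3)), (((1 + ‖x - y‖) ^ 4)⁻¹ / 4 + 3 / 4 * ((‖y‖ + a) ^ 4)⁻¹) :=
        integral_mono hint hmaj fun y => inv_mul_inv_cube_le x y ha
    _ = (∫ y : (EuclideanSpace ℝ (Fin 3)), ((1 + ‖y‖) ^ 4)⁻¹) / 4 + 3 / 4 * ∫ y : (EuclideanSpace ℝ (Fin 3)), ((‖y‖ + a) ^ 4)⁻¹ := by
        rw [integral_add ((integrable_inv_one_add_norm_sub_pow x (by norm_num)).div_const 4)
          ((integrable_inv_norm_add_pow ha (by norm_num)).const_mul _), integral_div,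
          integral_const_mul, integral_inv_one_add_norm_sub_pow]

/-! ## Comparison of the weights with pure powers -/

/-- `ρ⁻³ ≤ a^{θ-3} ‖y‖^{-θ}` for `0 ≤ θ ≤ 3`, `a > 0`, `y ≠ 0`
(`(‖y‖+a)³ = (‖y‖+a)^θ (‖y‖+a)^{3-θ} ≥ ‖y‖^θ a^{3-θ}`). [folklore] -/
theorem inv_norm_add_cube_le_rpow {a : ℝ} (ha : 0 < a) {θ : ℝ} (hθ0 : 0 ≤ θ) (hθ : θ ≤ 3)
    {y : (EuclideanSpace ℝ (Fin 3))} (hy : y ≠ 0) : ((‖y‖ + a) ^ 3)⁻¹ ≤ a ^ (θ - 3) * ‖y‖ ^ (-θ) := by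
  have hy0 : 0 < ‖y‖ := norm_pos_iff.2 hy
  have hya : 0 < ‖y‖ + a := by positivity
  have hsplit : (‖y‖ + a) ^ (3 : ℕ) = (‖y‖ + a) ^ θ * (‖y‖ + a) ^ (3 - θ) := by
    rw [← Real.rpow_add hya, add_sub_cancel, ← Real.rpow_natCast]; norm_num
  have hlow : ‖y‖ ^ θ * a ^ (3 - θ) ≤ (‖y‖ + a) ^ (3 : ℕ) := by
    rw [hsplit]
    exact mul_le_mul (Real.rpow_le_rpow hy0.le (by linarith) hθ0)
      (Real.rpow_le_rpow ha.le (by linarith) (by linarith)) (by positivity) (by positivity)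
  have hpos : 0 < ‖y‖ ^ θ * a ^ (3 - θ) := by positivity
  calc ((‖y‖ + a) ^ 3)⁻¹ ≤ (‖y‖ ^ θ * a ^ (3 - θ))⁻¹ := inv_anti₀ hpos hlow
    _ = a ^ (θ - 3) * ‖y‖ ^ (-θ) := by
        rw [mul_inv, Real.rpow_neg hy0.le, ← Real.rpow_neg ha.le, neg_sub, mul_comm]

/-- `(1 + ‖z‖)^{-k} ≤ ‖z‖^{-β}` for `0 ≤ β ≤ k` and `z ≠ 0`. [folklore] -/
theorem inv_one_add_norm_pow_le_rpow {k : ℕ} {β : ℝ} (hβ0 : 0 ≤ β) (hβ : β ≤ k) {z : (EuclideanSpace ℝ (Fin 3))}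
    (hz : z ≠ 0) : ((1 + ‖z‖) ^ k)⁻¹ ≤ ‖z‖ ^ (-β) := by
  have hz0 : 0 < ‖z‖ := norm_pos_iff.2 hz
  have h1 : (1 : ℝ) ≤ 1 + ‖z‖ := by linarith
  have hlow : ‖z‖ ^ β ≤ (1 + ‖z‖) ^ k := by
    calc ‖z‖ ^ β ≤ (1 + ‖z‖) ^ β := Real.rpow_le_rpow hz0.le (by linarith) hβ0
      _ ≤ (1 + ‖z‖) ^ (k : ℝ) := Real.rpow_le_rpow_of_exponent_le h1 hβ
      _ = (1 + ‖z‖) ^ k := Real.rpow_natCast _ _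
  rw [Real.rpow_neg hz0.le]
  exact inv_anti₀ (Real.rpow_pos_of_pos hz0 β) hlow

/-! ## The Riesz composition bound in real form -/

/-- **Riesz composition** (Stein, *Singular integrals*, V §1; the tree's
`RieszKernel.exists_lintegral_powKer_mul_powKer_le`) for Bochner integrals: for
`0 ≤ α, β < 3 < α + β` there is `K ≥ 0` such that for every `x ≠ 0` the function
`y ↦ ‖x - y‖^{-β} ‖y‖^{-α}` is integrable on `(EuclideanSpace ℝ (Fin 3))` with `∫ ‖x-y‖^{-β}‖y‖^{-α} dy ≤ K ‖x‖^{3-α-β}`. [folklore] -/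
theorem exists_integral_rpow_mul_rpow_le {α β : ℝ} (hα : 0 ≤ α) (hα3 : α < 3) (hβ : 0 ≤ β)
    (hβ3 : β < 3) (h3 : 3 < α + β) :
    ∃ K : ℝ, 0 ≤ K ∧ ∀ x : (EuclideanSpace ℝ (Fin 3)), x ≠ 0 →
      Integrable (fun y : (EuclideanSpace ℝ (Fin 3)) => ‖x - y‖ ^ (-β) * ‖y‖ ^ (-α)) volume ∧
        ∫ y : (EuclideanSpace ℝ (Fin 3)), ‖x - y‖ ^ (-β) * ‖y‖ ^ (-α) ≤ K * ‖x‖ ^ (3 - α - β) := by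
  obtain ⟨K, hK, hbound⟩ := exists_lintegral_powKer_mul_powKer_le hα hα3 hβ hβ3 h3
  refine ⟨K.toReal, ENNReal.toReal_nonneg, fun x hx => ?_⟩
  set f : (EuclideanSpace ℝ (Fin 3)) → ℝ := fun y => ‖x - y‖ ^ (-β) * ‖y‖ ^ (-α) with hf
  have hf0 : ∀ y, 0 ≤ f y := fun y => by positivity
  have hfm : Measurable f :=
    ((measurable_const.sub measurable_id).norm.pow_const _).mul (measurable_norm.pow_const _)
  have hlin : ∫⁻ y, ENNReal.ofReal (f y) = ∫⁻ y, powKer α y * powKer β (y - x) := by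
    refine lintegral_congr fun y => ?_
    rw [hf, powKer_sub_comm, powKer_apply, powKer_apply,
      ENNReal.ofReal_mul (Real.rpow_nonneg (norm_nonneg _) _), mul_comm]
  have hle : ∫⁻ y, ENNReal.ofReal (f y) ≤ K * ENNReal.ofReal (‖x‖ ^ (3 - α - β)) := by
    rw [hlin]; exact hbound x hx
  have hlt : ∫⁻ y, ENNReal.ofReal (f y) < ⊤ :=
    lt_of_le_of_lt hle (ENNReal.mul_lt_top hK ENNReal.ofReal_lt_top)
  have hint : Integrable f volume := by
    refine ⟨hfm.aestronglyMeasurable, ?_⟩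
    rw [hasFiniteIntegral_iff_enorm]
    calc ∫⁻ y, ‖f y‖ₑ = ∫⁻ y, ENNReal.ofReal (f y) :=
          lintegral_congr fun y => (Real.enorm_eq_ofReal (hf0 y))
      _ < ⊤ := hlt
  refine ⟨hint, ?_⟩
  rw [integral_eq_lintegral_of_nonneg_ae (Eventually.of_forall hf0) hfm.aestronglyMeasurable]
  calc (∫⁻ y, ENNReal.ofReal (f y)).toReal ≤ (K * ENNReal.ofReal (‖x‖ ^ (3 - α - β))).toReal :=
        ENNReal.toReal_mono (ENNReal.mul_ne_top hK.ne ENNReal.ofReal_ne_top) hle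
    _ = K.toReal * ‖x‖ ^ (3 - α - β) := by
        rw [ENNReal.toReal_mul, ENNReal.toReal_ofReal (Real.rpow_nonneg (norm_nonneg _) _)]

/-! ## `ρ⁻³ ‖x‖^{-s}` is integrable -/

/-- **`x ↦ ρ(x)⁻³ ‖x‖^{-s} ∈ L¹((EuclideanSpace ℝ (Fin 3)))` for `a > 0`, `0 < s < 3`** (on the unit ball `≤ a⁻³‖x‖^{-s}`,
integrable since `s < 3`; off it `≤ ‖x‖^{-(3+s)}`, integrable since `3 + s > 3`;
the tree's `lintegral_ball_powKer_lt_top`, `lintegral_compl_ball_powKer_lt_top`). [folklore] -/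
theorem integrable_inv_norm_add_cube_mul_rpow {a : ℝ} (ha : 0 < a) {s : ℝ} (hs0 : 0 < s)
    (hs : s < 3) :
    Integrable (fun x : (EuclideanSpace ℝ (Fin 3)) => ((‖x‖ + a) ^ 3)⁻¹ * ‖x‖ ^ (-s)) volume := by
  set f : (EuclideanSpace ℝ (Fin 3)) → ℝ := fun x => ((‖x‖ + a) ^ 3)⁻¹ * ‖x‖ ^ (-s) with hf
  have hf0 : ∀ x, 0 ≤ f x := fun x => by positivity
  have hfm : Measurable f :=
    ((measurable_norm.add_const a).pow_const 3).inv.mul (measurable_norm.pow_const _)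
  -- on the unit ball
  have hball : ∫⁻ x in ball (0 : (EuclideanSpace ℝ (Fin 3))) 1, ENNReal.ofReal (f x) < ⊤ := by
    have hle : ∀ x : (EuclideanSpace ℝ (Fin 3)), ENNReal.ofReal (f x) ≤ ENNReal.ofReal (a ^ 3)⁻¹ * powKer s x := by
      intro x
      rw [powKer_apply, ← ENNReal.ofReal_mul (by positivity)]
      refine ENNReal.ofReal_le_ofReal (mul_le_mul_of_nonneg_right ?_ (by positivity))
      rw [← inv_pow, ← inv_pow]
      exact pow_le_pow_left₀ (by positivity)
        (inv_anti₀ ha (le_add_of_nonneg_left (norm_nonneg _))) 3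
    calc ∫⁻ x in ball (0 : (EuclideanSpace ℝ (Fin 3))) 1, ENNReal.ofReal (f x)
        ≤ ∫⁻ x in ball (0 : (EuclideanSpace ℝ (Fin 3))) 1, ENNReal.ofReal (a ^ 3)⁻¹ * powKer s x :=
          lintegral_mono fun x => hle x
      _ = ENNReal.ofReal (a ^ 3)⁻¹ * ∫⁻ x in ball (0 : (EuclideanSpace ℝ (Fin 3))) 1, powKer s x :=
          lintegral_const_mul' _ _ ENNReal.ofReal_ne_top
      _ < ⊤ := ENNReal.mul_lt_top ENNReal.ofReal_lt_top (lintegral_ball_powKer_lt_top hs 1)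
  -- off the unit ball
  have hfar : ∫⁻ x in (ball (0 : (EuclideanSpace ℝ (Fin 3))) 1)ᶜ, ENNReal.ofReal (f x) < ⊤ := by
    have hle : ∀ x ∈ (ball (0 : (EuclideanSpace ℝ (Fin 3))) 1)ᶜ, ENNReal.ofReal (f x) ≤ powKer (3 + s) x := by
      intro x hx
      have hx1 : 1 ≤ ‖x‖ := by simpa using hx
      have hx0 : 0 < ‖x‖ := by linarith
      rw [powKer_apply]
      refine ENNReal.ofReal_le_ofReal ?_
      show ((‖x‖ + a) ^ 3)⁻¹ * ‖x‖ ^ (-s) ≤ ‖x‖ ^ (-(3 + s))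
      rw [show -(3 + s) = (-3 : ℝ) + -s by ring, Real.rpow_add hx0]
      refine mul_le_mul_of_nonneg_right ?_ (by positivity)
      rw [Real.rpow_neg hx0.le, show (3 : ℝ) = ((3 : ℕ) : ℝ) by norm_num, Real.rpow_natCast]
      exact inv_anti₀ (by positivity) (pow_le_pow_left₀ hx0.le (by linarith) 3)
    calc ∫⁻ x in (ball (0 : (EuclideanSpace ℝ (Fin 3))) 1)ᶜ, ENNReal.ofReal (f x)
        ≤ ∫⁻ x in (ball (0 : (EuclideanSpace ℝ (Fin 3))) 1)ᶜ, powKer (3 + s) x :=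
          setLIntegral_mono' isOpen_ball.measurableSet.compl hle
      _ < ⊤ := lintegral_compl_ball_powKer_lt_top (by linarith) one_pos
  refine ⟨hfm.aestronglyMeasurable, ?_⟩
  rw [hasFiniteIntegral_iff_enorm]
  calc ∫⁻ x, ‖f x‖ₑ = ∫⁻ x, ENNReal.ofReal (f x) :=
        lintegral_congr fun x => Real.enorm_eq_ofReal (hf0 x)
    _ = (∫⁻ x in ball (0 : (EuclideanSpace ℝ (Fin 3))) 1, ENNReal.ofReal (f x)) +
          ∫⁻ x in (ball (0 : (EuclideanSpace ℝ (Fin 3))) 1)ᶜ, ENNReal.ofReal (f x) :=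
        (lintegral_add_compl _ measurableSet_ball).symm
    _ < ⊤ := ENNReal.add_lt_top.2 ⟨hball, hfar⟩

/-! ## Registered sub-goal (helper stub of `stub_coulombEnergyPackage`) -/

/-- **Registered helper stub `stub_rieszCompositionReal`** (crux stmt-NavierStokesRegularity-11717,
line `finite-energy-log-convexity`, helper of S4-E): the Riesz composition bound for Bochner
integrals on `(EuclideanSpace ℝ (Fin 3))`, as registered. [folklore] -/
theorem stub_rieszCompositionReal :
    ∀ (α β : ℝ), 0 ≤ α → α < 3 → 0 ≤ β → β < 3 → 3 < α + β →
      ∃ K : ℝ, 0 ≤ K ∧ ∀ x : EuclideanSpace ℝ (Fin 3), x ≠ 0 →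
        Integrable (fun y : EuclideanSpace ℝ (Fin 3) => ‖x - y‖ ^ (-β) * ‖y‖ ^ (-α)) volume ∧
          ∫ y : EuclideanSpace ℝ (Fin 3), ‖x - y‖ ^ (-β) * ‖y‖ ^ (-α) ≤ K * ‖x‖ ^ (3 - α - β) :=
  fun _α _β hα hα3 hβ hβ3 h3 => exists_integral_rpow_mul_rpow_le hα hα3 hβ hβ3 h3

end Summit.NavierStokesRegularity.NavierStokesRegularity.Theorems.RellichScarScarRigidity

end
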